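import Literature.AlgebraicGeometry.Resolution.GeometricallyRegularFG
import Literature.AlgebraicGeometry.Resolution.RegularHomRegularLocus
import Literature.AlgebraicGeometry.Resolution.RegularFormalFibres
import Literature.AlgebraicGeometry.Resolution.OriginLocalRing
import Mathlib.FieldTheory.IsAlgClosed.Basic
import Mathlib.RingTheory.TensorProduct.Quotient
import Mathlib.RingTheory.LocalRing.ResidueField.Ideal
import HarnessLib

/-!
# [OURS · L1 W4.5(b) · EL♮(3)] ND-K5 (B4β2) RING-LEVEL CORE — regularity ascends along the base change of the frame chart at primes over the origin

OURS · L1 W4.5(b) · EL♮(3) stmt-ResolutionOfSingularities-20148 (parent EL♮ stmt-…-20038) · counted 0 · AI-written (res-L1-w45b-iso-w2 g0, WIDTH seat on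
D-0157 DOOR 1, desk WIDTH TABLE D1′ row iso-w2 = (B4β2) `transportEnd`), weaker than expert review; nothing of [Hironaka2017] asserted; no statement of the
manuscript; resolution of singularities in positive characteristic is NOT proved here or by this.  Def-free, sorry-free, standard axioms.
`--supports stmt-ResolutionOfSingularities-20148 --as helper`.

WHAT (pure commutative algebra; the scheme glue of (B4β2) `ND.transportEnd` reduces to this at an affine chart of the model toric stage).  Let `k` be an
ALGEBRAICALLY CLOSED field, `R = k[X₁, …, Xₙ]`, `𝔪₀ = (X₁, …, Xₙ)` the origin.  Let `Λ` be a Noetherian FLAT `R`-algebra with `𝔪₀Λ` MAXIMAL (in (B4β2):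
`Λ = 𝒪_{F₁,x}` through the frame chart `Xᵢ ↦ wᵢ`, flat by `ND.flat_frameChart` ✓ p642337, `𝔪₀Λ = 𝔪ₓ` by `ND.map_originIdeal_frameChart`; the residue
field `κ(x) = Λ/𝔪₀Λ ⊇ k` is an ARBITRARY extension — `κ(x) = k` is never assumed), and let `A₀` be a Noetherian `R`-algebra essentially of finite type
(in (B4β2): the coordinate ring of a toric chart `𝔸ⁿ_k ≅ U ⊆ A` over `𝔸ⁿ_k`).  Then for every prime `𝔔` of `A₀ ⊗_R Λ` lying over the ORIGIN of `R`:

  `(A₀ ⊗_R Λ)_𝔔` is a regular local ring  ⟺  `(A₀)_{𝔔 ∩ A₀}` is a regular local ring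

(`isRegularLocalRing_localization_tensor_iff_of_under_eq_originIdeal`).  PROOF.  `A₀ → A₀ ⊗_R Λ` is flat (base change); the fibre ring over
`𝔭 = 𝔔 ∩ A₀` is `κ(𝔭) ⊗_{A₀} (A₀ ⊗_R Λ) ≅ κ(𝔭) ⊗_R Λ ≅ κ(𝔭) ⊗_{k₀} (Λ/𝔪₀Λ)` with `k₀ = R/𝔪₀ ≅ k` (because `𝔭 ⊇ 𝔪₀`), and this ring is REGULAR:
`Λ/𝔪₀Λ` is a field, hence geometrically regular over the algebraically closed field `k₀` (`isGeometricallyRegular_of_isAlgClosed`: `k₀` has no finite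
extension but itself), and `κ(𝔭)` is a finitely generated field extension of `k₀`, so Stacks 0381 (tree
`Literature…IsGeometricallyRegular.isRegularRing_baseChange_of_fg`) applies; then EGA IV₂ 6.5.1/6.5.2 = Matsumura 23.7 with the flat dimension formula
(tree `Literature…isRegularLocalRing_localization_iff_of_isRegularRing_fiber`, `RegularFormalFibres.lean`).

FEEDS.  (B4β2) `ND.transportEnd` (SPEC v11 §13.15): regularity of the F-side stage at points over `x` (`𝒪_{F,y} ≅ 𝒪_{L,ℓ} = (Γ(A,U) ⊗_R 𝒪_{F₁,x})_𝔔`) from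
regularity of the model toric stage, and — applied to `A₀/J` — regularity of the reduced strict transform over `x` (END) from END of the model.
-/

set_option linter.dupNamespace false

open TensorProduct IsLocalRing

namespace Summit.ResolutionOfSingularities.ResolutionOfSingularities.Cruxes.EquisingularLiftNat.Sections.ND

universe u

/-- **An algebraically closed field is "geometrically regular-making"**: every REGULAR Noetherian `k`-algebra `F` is geometrically regular over the
algebraically closed field `k` — a finite extension `k'/k` is `k` itself (`IsAlgClosed.algebraMap_bijective_of_isIntegral`), so `k' ⊗_k F ≅ F`.
[OURS · L1 W4.5b · ND-K5 (B4β2) algebra] -/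
theorem isGeometricallyRegular_of_isAlgClosed (k F : Type u) [Field k] [IsAlgClosed k] [CommRing F] [Algebra k F] [IsRegularRing F] :
    Literature.AlgebraicGeometry.Resolution.IsGeometricallyRegular k F := by
  intro k' _ _ hfin
  haveI := hfin
  haveI : Algebra.IsIntegral k k' := Algebra.IsIntegral.of_finite k k'
  -- `k → k'` is bijective, so `k' ≃ₐ[k] k`
  let e₀ : k ≃ₐ[k] k' := AlgEquiv.ofBijective (Algebra.ofId k k') (IsAlgClosed.algebraMap_bijective_of_isIntegral (k := k) (K := k'))
  let e : k' ⊗[k] F ≃ₐ[k] F :=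
    (Algebra.TensorProduct.congr e₀.symm (AlgEquiv.refl : F ≃ₐ[k] F)).trans (Algebra.TensorProduct.lid k F)
  exact IsRegularRing.of_ringEquiv (R := F) e.symm.toRingEquiv

/-- **The fibre of a base change of the frame chart over the origin is a regular ring.**  `k` algebraically closed, `R = k[X₁, …, Xₙ]`, `𝔪₀` the origin;
`Λ` a Noetherian `R`-algebra with `𝔪₀Λ` maximal; `A₀` an `R`-algebra essentially of finite type; `𝔭` a prime of `A₀` over `𝔪₀`.  Then
`κ(𝔭) ⊗_{A₀} (A₀ ⊗_R Λ) ≅ κ(𝔭) ⊗_{R/𝔪₀} Λ/𝔪₀Λ` is a regular ring (Stacks 0381 over the algebraically closed `R/𝔪₀ ≅ k`; `κ(𝔭)` is finitely generated over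
it). [OURS · L1 W4.5b · ND-K5 (B4β2) algebra] -/
theorem isRegularRing_fiber_tensor_of_liesOver_originIdeal (k : Type u) [Field k] [IsAlgClosed k] (n : ℕ)
    {A₀ Λ : Type u} [CommRing A₀] [CommRing Λ] [Algebra (MvPolynomial (Fin n) k) A₀] [Algebra (MvPolynomial (Fin n) k) Λ]
    [IsNoetherianRing Λ] [Algebra.EssFiniteType (MvPolynomial (Fin n) k) A₀]
    (hΛ : (Ideal.map (algebraMap (MvPolynomial (Fin n) k) Λ) (Literature.AlgebraicGeometry.Resolution.originIdeal k n)).IsMaximal)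
    (p : Ideal A₀) [p.IsPrime] [p.LiesOver (Literature.AlgebraicGeometry.Resolution.originIdeal k n)] :
    IsRegularRing (p.Fiber (A₀ ⊗[MvPolynomial (Fin n) k] Λ)) := by
  set R := MvPolynomial (Fin n) k with hR
  set m₀ : Ideal R := Literature.AlgebraicGeometry.Resolution.originIdeal k n with hm₀
  -- the residue field `k₀ = R/𝔪₀ ≅ k` is algebraically closed
  letI : Field (R ⧸ m₀) := Ideal.Quotient.field m₀
  have ek : (R ⧸ m₀) ≃+* k :=
    RingHom.quotientKerEquivOfSurjective (Literature.AlgebraicGeometry.Resolution.constantCoeff_surjective k n)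
  haveI : IsAlgClosed (R ⧸ m₀) := IsAlgClosed.of_ringEquiv k (R ⧸ m₀) ek.symm
  -- the fibre `K₀ = Λ/𝔪₀Λ` is a field, hence a regular ring, hence geometrically regular over `k₀`
  letI : Field (Λ ⧸ Ideal.map (algebraMap R Λ) m₀) := Ideal.Quotient.field _
  haveI : IsRegularRing (Λ ⧸ Ideal.map (algebraMap R Λ) m₀) := inferInstance
  have hGR : Literature.AlgebraicGeometry.Resolution.IsGeometricallyRegular (R ⧸ m₀) (Λ ⧸ Ideal.map (algebraMap R Λ) m₀) :=
    isGeometricallyRegular_of_isAlgClosed _ _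
  -- `κ(𝔭)` is a `k₀`-algebra (𝔭 lies over 𝔪₀), essentially of finite type, i.e. a finitely generated field extension
  have hker : ∀ a ∈ m₀, algebraMap R p.ResidueField a = 0 := by
    intro a ha
    rw [IsScalarTower.algebraMap_apply R A₀ p.ResidueField, Ideal.algebraMap_residueField_eq_zero]
    have : a ∈ p.under R := by rw [← Ideal.LiesOver.over (p := m₀) (P := p)]; exact ha
    exact this
  letI alg : Algebra (R ⧸ m₀) p.ResidueField := (Ideal.Quotient.lift m₀ (algebraMap R p.ResidueField) hker).toAlgebra
  haveI tower : IsScalarTower R (R ⧸ m₀) p.ResidueField :=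
    IsScalarTower.of_algebraMap_eq fun a => by
      change algebraMap R p.ResidueField a = Ideal.Quotient.lift m₀ (algebraMap R p.ResidueField) hker (Ideal.Quotient.mk m₀ a)
      rw [Ideal.Quotient.lift_mk]
  haveI : Algebra.EssFiniteType R p.ResidueField := Algebra.EssFiniteType.comp R A₀ p.ResidueField
  haveI : Algebra.EssFiniteType (R ⧸ m₀) p.ResidueField := Algebra.EssFiniteType.of_comp R (R ⧸ m₀) p.ResidueField
  have hfg : (⊤ : IntermediateField (R ⧸ m₀) p.ResidueField).FG := IntermediateField.fg_top_iff.mpr inferInstance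
  -- Stacks 0381: `κ(𝔭) ⊗_{k₀} K₀` is a regular ring
  haveI hreg : IsRegularRing (p.ResidueField ⊗[R ⧸ m₀] (Λ ⧸ Ideal.map (algebraMap R Λ) m₀)) :=
    hGR.isRegularRing_baseChange_of_fg p.ResidueField hfg
  -- the fibre ring is isomorphic to it
  let e₁ : p.Fiber (A₀ ⊗[R] Λ) ≃ₐ[A₀] p.ResidueField ⊗[R] Λ :=
    Algebra.TensorProduct.cancelBaseChange R A₀ A₀ p.ResidueField Λ
  let e₂ : p.ResidueField ⊗[R ⧸ m₀] ((R ⧸ m₀) ⊗[R] Λ) ≃ₐ[R ⧸ m₀] p.ResidueField ⊗[R] Λ :=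
    Algebra.TensorProduct.cancelBaseChange R (R ⧸ m₀) (R ⧸ m₀) p.ResidueField Λ
  let e₃ : (R ⧸ m₀) ⊗[R] Λ ≃ₐ[R ⧸ m₀] Λ ⧸ Ideal.map (algebraMap R Λ) m₀ :=
    (Algebra.TensorProduct.quotIdealMapEquivQuotTensor Λ m₀).symm
  let e₄ : p.ResidueField ⊗[R ⧸ m₀] ((R ⧸ m₀) ⊗[R] Λ) ≃ₐ[R ⧸ m₀] p.ResidueField ⊗[R ⧸ m₀] (Λ ⧸ Ideal.map (algebraMap R Λ) m₀) :=
    Algebra.TensorProduct.congr AlgEquiv.refl e₃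
  exact IsRegularRing.of_ringEquiv (R := p.ResidueField ⊗[R ⧸ m₀] (Λ ⧸ Ideal.map (algebraMap R Λ) m₀))
    (e₄.symm.toRingEquiv.trans (e₂.toRingEquiv.trans e₁.symm.toRingEquiv))

/-- **(B4β2) RING-LEVEL CORE.**  `k` algebraically closed, `R = k[X₁, …, Xₙ]`; `Λ` a Noetherian FLAT `R`-algebra with `(X₁, …, Xₙ)Λ` maximal; `A₀` a
Noetherian `R`-algebra essentially of finite type with `A₀ ⊗_R Λ` Noetherian; `𝔔` a prime of `A₀ ⊗_R Λ` lying over the origin of `R`.  Then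
`(A₀ ⊗_R Λ)_𝔔` is a regular local ring iff `(A₀)_{𝔔 ∩ A₀}` is.  [OURS · L1 W4.5b · ND-K5 (B4β2) algebra] -/
theorem isRegularLocalRing_localization_tensor_iff_of_under_eq_originIdeal (k : Type u) [Field k] [IsAlgClosed k] (n : ℕ)
    {A₀ Λ : Type u} [CommRing A₀] [CommRing Λ] [Algebra (MvPolynomial (Fin n) k) A₀] [Algebra (MvPolynomial (Fin n) k) Λ]
    [IsNoetherianRing A₀] [IsNoetherianRing Λ] [Algebra.EssFiniteType (MvPolynomial (Fin n) k) A₀]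
    [Module.Flat (MvPolynomial (Fin n) k) Λ] [IsNoetherianRing (A₀ ⊗[MvPolynomial (Fin n) k] Λ)]
    (hΛ : (Ideal.map (algebraMap (MvPolynomial (Fin n) k) Λ) (Literature.AlgebraicGeometry.Resolution.originIdeal k n)).IsMaximal)
    (Q : Ideal (A₀ ⊗[MvPolynomial (Fin n) k] Λ)) [Q.IsPrime]
    (hQ : Q.under (MvPolynomial (Fin n) k) = Literature.AlgebraicGeometry.Resolution.originIdeal k n) :
    IsRegularLocalRing (Localization.AtPrime Q) ↔ IsRegularLocalRing (Localization.AtPrime (Q.under A₀)) := by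
  haveI : (Q.under A₀).LiesOver (Literature.AlgebraicGeometry.Resolution.originIdeal k n) :=
    ⟨by rw [Ideal.under_under]; exact hQ.symm⟩
  exact Literature.AlgebraicGeometry.Resolution.isRegularLocalRing_localization_iff_of_isRegularRing_fiber Q
    (isRegularRing_fiber_tensor_of_liesOver_originIdeal k n hΛ (Q.under A₀))

end Summit.ResolutionOfSingularities.ResolutionOfSingularities.Cruxes.EquisingularLiftNat.Sections.ND
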